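import Summits.AtomisticToContinuum.HydrodynamicLimit.Theorems.JParityClosureLocalSecondLawRegularRangeGrid
import Summits.AtomisticToContinuum.HydrodynamicLimit.Theorems.JParityClosureDensityCap

/-!
# The regular range from the fixed-time field law of large numbers
# (`regularRange_of_fieldLLN`, reduction for stub F = `stub_regularRange` of the line
# `exact-entropy-ledger-three-passivities`, crux `JParityClosure.LocalSecondLaw`, stmt-AtomisticToContinuum-13081)

Stub F of the entropy-ledger line asks that, with local-Gibbs probability `≥ 1 − δ`, the orbit is good and
the cone-mollified empirical fields stay in the REGULAR RANGE `c ≤ ρ_r`, `ρ_rσ³ ≤ η₁`, `c ≤ θ_r` on ALL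
of `[0, τ] × 𝕋³` (`LocalSecondLawLedger.Regular`), for `r < r₀` and `N ≥ N₀(r)`. At times `s > 0`
nothing short of the hydrodynamic limit controls the law, so F is registered as an open stub. This file
proves the measure-theoretic REDUCTION of F to fixed-time inputs, in the pattern of the grid upgrade of the
sibling crux `DensityCap` (`Theorems/JParityClosureDensityCapGridUpgrade.lean`), two-sided and for the three
fields `(ρ_r, m_r, e_r)`:

* `regularRange_of_fieldLLN` — for continuous limit fields `(ρ, u, θ)` on `[0, τ] × 𝕋³` with `ρ, θ > 0`
  and `ρσ³ < η₁`: (H1) the fixed-time field law of large numbers `TendstoHydroFieldsAt … s` at every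
  `s ∈ [0, τ]` and (H2) local-in-time equicontinuity in probability of the coarse momentum and kinetic
  energy at a fixed centre imply `P_N(¬ Regular σ r τ c η₁ (Φ N)) ≤ δ` for a floor `c > 0` depending only
  on the limit fields, all `δ > 0`, `r < r₀` and `N ≥ N₀(r)`;
* `regularRange_of_fieldLLN_euler` — the same in the crux's frame (`τ < T`, classical Euler solution).

Why (H2) is a hypothesis: the coarse DENSITY has a Lipschitz clock along good orbits (positions move at
quadratic-mean speed `√(2K)`, `stub_meanDisplacement`, `gridUp_clock`), but the velocity-weighted fields
`m_r, e_r` jump at collisions (transfer `(N+1)⁻¹(b_r(xᵢ) − b_r(xⱼ))Δvᵢ`, summed over `O(N^{4/3})`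
collisions per unit time) and stream with the uncontrolled cubic velocity moment, so no pathwise modulus in
time exists; their time control is genuinely probabilistic (collision tightness + kinetic-energy tails,
uniformly on short windows), which is what (H2) names.

Tools (`Theorems/JParityClosureLocalSecondLawRegularRangeTools.lean`): joint modulus / floor / bound of a
field from continuity of its space–time lift (`rr_modulus`, `rr_exists_floor`, `rr_exists_bound`),
centre-Lipschitz bounds of the coarse momentum and kinetic energy, the two-sided cone-average error, and
the point estimate `regularAt_of_fieldsClose` (pure real arithmetic: hot or dense limit states only help
the temperature floor, so only a bound on `‖u‖` enters); the deterministic grid bookkeeping is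
`regular_of_gridEvents` (`Theorems/JParityClosureLocalSecondLawRegularRangeGrid.lean`).

References: C. Kipnis, C. Landim, *Scaling Limits of Interacting Particle Systems* (1999), Ch. 4 (moduli
of continuity as the route from fixed-time to uniform-in-time statements); H. Spohn, *Large Scale Dynamics
of Interacting Particles* (1991), Part I §3 (setting); the vocabulary is that of
`Theorems/JParityClosureLocalSecondLawLedgerDefs.lean` and `Theorems/LocalSecondLaw/Negative/Functional.lean`.
-/

noncomputable section

namespace Summit.AtomisticToContinuum.HydrodynamicLimit.Theorems.LocalSecondLawLedger

open scoped BigOperators Topology Classical MeasureTheory ENNReal InnerProductSpace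
open Filter Set MeasureTheory
open Literature.MathematicalPhysics.KineticTheory
open Literature.Analysis.FluidPDE
open Literature.Analysis.FunctionSpaces (Torus.stLift Torus.stLift_apply Torus.proj Torus.proj_add
  Torus.continuous_slice_of_continuousOn_stLift Torus.continuousOn_stLift_comp₂)
open Summit.AtomisticToContinuum.HydrodynamicLimit.Theorems.LocalSecondLawNegative

/-! ## The reduction: the regular range from the fixed-time field law of large numbers -/

/-- **F from the fixed-time field LLN plus time-equicontinuity of the velocity-weighted coarse fields.**
For ANY reduced density `σ`, cap level `η₁`, horizon `τ`, profiles, flow family `Φ` and limit fields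
`(ρ, u, θ)` with continuous space–time lifts on `[0, τ] × ℝ³` and `ρ > 0`, `θ > 0`, `ρσ³ < η₁` on
`[0, τ] × 𝕋³`: IF (H1) at every FIXED `s ∈ [0, τ]` the empirical density / momentum / energy fields of
`Φ_N(s) z` converge in `P_N`-probability to `(ρ, ρu, E)(s)` against continuous tests
(`TendstoHydroFieldsAt … s`; at `s = 0` this is the crux's tie), and (H2) for all small `r`, every
centre `x`, every `s ∈ [0, τ]` and `ε > 0` there is a window `ϖ > 0` on which the oscillation about time
`s` of the coarse momentum and kinetic energy `(m_r, e_r)(Φ_N(·) z)(x)` exceeds `ε` only with vanishing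
`P_N`-probability — THEN there is a floor `c > 0` (depending only on the limit fields) such that for every
`δ > 0`, all small `r` and all large `N` the complement of the regular event `Regular σ r τ c η₁ (Φ N)`
(good orbit, `c ≤ ρ_r`, `ρ_rσ³ ≤ η₁`, `c ≤ θ_r` on ALL of `[0, τ] × 𝕋³`) has `P_N`-probability `≤ δ`.
Proof (the grid upgrade of `JParityClosureDensityCapGridUpgrade`, two-sided and for three fields):
floors, cap gap, velocity bound and a joint modulus of the limit fields by compactness
(`rr_exists_floor`, `rr_exists_bound`, `rr_modulus`); at fixed `r` a finite `x`-net of mesh `δx`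
(`gridUp_euclidNet`) and, by compactness of `[0, τ]`, a finite time net whose windows are the minima of
the clock mesh and the (H2) windows of the net centres; the coarse density is `3/(πr⁴)`-Lipschitz in
the centre and `3/(πr⁴)√(2K)`-Lipschitz in time along good orbits (`gridUp_clock`,
`stub_meanDisplacement`; `K` from the `χ ≡ 1` energy instance of (H1) at `s = 0`, `energyTight_of_tie`);
the coarse momentum / energy are `3/(πr⁴)(1 + K)`-Lipschitz in the centre and controlled in time by the
(H2) events; at the net points (H1) with the continuous tests `b_r(·, x_l)` and the two-sided cone-average
error (`∫ b_r = 1`) tie the coarse fields to the limit fields; chaining five links of size `ε/5` gives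
`|ρ_r − ρ|, ‖m_r − ρu‖, |e_r − E| ≤ ε` on `[0, τ] × 𝕋³` off a finite union of events of vanishing
probability (plus the null bad set and the energy event), and `regularAt_of_fieldsClose` turns this into the
regular inequalities. There is NO Lipschitz clock for `m_r, e_r` (collisional transfer, fast streaming),
which is why (H2) is a hypothesis and not a lemma. -/
theorem regularRange_of_fieldLLN :
  ∀ (σ η₁ τ : ℝ) (a₀ θ₀ : T3 → ℝ) (u₀ : T3 → V3) (Φ : (N : ℕ) → Flow σ N)
    (ρ θ : ℝ → T3 → ℝ) (u : ℝ → T3 → V3),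
    ContinuousOn (Literature.Analysis.FunctionSpaces.Torus.stLift ρ) (Set.Icc 0 τ ×ˢ Set.univ) →
    ContinuousOn (Literature.Analysis.FunctionSpaces.Torus.stLift u) (Set.Icc 0 τ ×ˢ Set.univ) →
    ContinuousOn (Literature.Analysis.FunctionSpaces.Torus.stLift θ) (Set.Icc 0 τ ×ˢ Set.univ) →
    (∀ s ∈ Set.Icc 0 τ, ∀ x, 0 < ρ s x ∧ 0 < θ s x ∧ ρ s x * σ ^ 3 < η₁) →
    (∀ s ∈ Set.Icc 0 τ, TendstoHydroFieldsAt (fun N => localGibbsLaw σ a₀ u₀ θ₀ N (Φ N)) Φ ρ u θ s) →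
    (∃ r₁ : ℝ, 0 < r₁ ∧ ∀ r : ℝ, 0 < r → r < r₁ → ∀ x : T3, ∀ s ∈ Set.Icc 0 τ, ∀ ε : ℝ, 0 < ε →
      ∃ ϖ : ℝ, 0 < ϖ ∧ Tendsto (fun N => localGibbsLaw σ a₀ u₀ θ₀ N (Φ N)
        {z | ∃ s' ∈ Set.Icc 0 τ, |s' - s| ≤ ϖ ∧
          ε < ‖momC r ((Φ N).flow s' z) x - momC r ((Φ N).flow s z) x‖ +
            |kinC r ((Φ N).flow s' z) x - kinC r ((Φ N).flow s z) x|}) atTop (𝓝 0)) →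
    ∃ c : ℝ, 0 < c ∧ ∀ δ : ℝ, 0 < δ → ∃ r₀ : ℝ, 0 < r₀ ∧ ∀ r : ℝ, 0 < r → r < r₀ →
      ∃ N₀ : ℕ, ∀ N : ℕ, N₀ ≤ N →
        localGibbsLaw σ a₀ u₀ θ₀ N (Φ N) {z | ¬ Regular σ r τ c η₁ (Φ N) z} ≤ ENNReal.ofReal δ := by
  intro σ η₁ τ a₀ θ₀ u₀ Φ ρ θ u hρc huc hθc hpos hlln hosc
  set P : (N : ℕ) → Measure (Phase N) := fun N => localGibbsLaw σ a₀ u₀ θ₀ N (Φ N) with hPdef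
  rcases lt_or_ge τ 0 with hτ | hτ
  · -- empty time interval: the regular event is the good set
    refine ⟨1, one_pos, fun δ hδ => ⟨1, one_pos, fun r hr hr1 => ⟨0, fun N _ => ?_⟩⟩⟩
    have hsub : {z | ¬ Regular σ r τ 1 η₁ (Φ N) z} ⊆ (Φ N).goodᶜ := by
      intro z hz hg
      exact hz ⟨hg, fun s hs => ((not_le.2 hτ) (hs.1.trans hs.2)).elim⟩
    calc P N {z | ¬ Regular σ r τ 1 η₁ (Φ N) z} ≤ P N (Φ N).goodᶜ := measure_mono hsub
      _ = 0 := gridUp_localGibbsLaw_compl_good σ a₀ θ₀ u₀ N (Φ N)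
      _ ≤ ENNReal.ofReal δ := zero_le
  -- Step 0: Euler-side constants by compactness
  obtain ⟨mρ, hmρ, hmρle⟩ := rr_exists_floor hτ hρc fun s hs x => (hpos s hs x).1
  obtain ⟨mθ, hmθ, hmθle⟩ := rr_exists_floor hτ hθc fun s hs x => (hpos s hs x).2.1
  have hgapc : ContinuousOn (Torus.stLift fun s x => η₁ - ρ s x * σ ^ 3) (Icc 0 τ ×ˢ univ) :=
    Torus.continuousOn_stLift_comp₂ hρc hρc (Φ := fun a _ => η₁ - a * σ ^ 3)
      (show Continuous fun p : ℝ × ℝ => η₁ - p.1 * σ ^ 3 by fun_prop)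
  obtain ⟨g₀, hg₀, hg₀le⟩ := rr_exists_floor hτ hgapc fun s hs x => by
    have := (hpos s hs x).2.2
    show 0 < η₁ - ρ s x * σ ^ 3
    linarith
  obtain ⟨B, hB0, hBle⟩ := rr_exists_bound huc
  -- the floor `c` and the tolerance `ε`
  set c : ℝ := min (mρ / 2) (mθ / 2) with hcdef
  have hc : 0 < c := lt_min (half_pos hmρ) (half_pos hmθ)
  have hcρ : ∀ s ∈ Icc 0 τ, ∀ x, 2 * c ≤ ρ s x := fun s hs x => by
    have h1 := hmρle s hs x
    have h2 := min_le_left (mρ / 2) (mθ / 2)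
    linarith
  have hcθ : ∀ s ∈ Icc 0 τ, ∀ x, 2 * c ≤ θ s x := fun s hs x => by
    have h1 := hmθle s hs x
    have h2 := min_le_right (mρ / 2) (mθ / 2)
    linarith
  set D : ℝ := B ^ 2 + 2 * B + 3 * c + 2 with hDdef
  have hD : 0 < D := by positivity
  set ε : ℝ := min (g₀ / (|σ ^ 3| + 1)) (c ^ 2 / D) with hεdef
  have hε : 0 < ε := lt_min (by positivity) (by positivity)
  have hεg : ε * (|σ ^ 3| + 1) ≤ g₀ := by
    rw [← le_div_iff₀ (by positivity)]
    exact min_le_left _ _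
  have hεD : ε * D ≤ c ^ 2 := by
    rw [← le_div_iff₀ hD]
    exact min_le_right _ _
  set ε₅ : ℝ := ε / 5 with hε₅def
  have hε₅ : 0 < ε₅ := by positivity
  -- continuity of the limit fields ρ • u and E
  have hmc : ContinuousOn (Torus.stLift fun s x => ρ s x • u s x) (Icc 0 τ ×ˢ univ) :=
    Torus.continuousOn_stLift_comp₂ hρc huc (Φ := fun a b => a • b) continuous_smul
  have hEc : ContinuousOn (Torus.stLift fun s x => totalEnergyDensity (ρ s x) (u s x) (θ s x))
      (Icc 0 τ ×ˢ univ) := by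
    have h1 : ContinuousOn (Torus.stLift fun s x => ‖u s x‖ ^ 2 / 2 + 3 / 2 * θ s x) (Icc 0 τ ×ˢ univ) :=
      Torus.continuousOn_stLift_comp₂ huc hθc (Φ := fun a b => ‖a‖ ^ 2 / 2 + 3 / 2 * b)
        (show Continuous fun p : V3 × ℝ => ‖p.1‖ ^ 2 / 2 + 3 / 2 * p.2 by fun_prop)
    exact Torus.continuousOn_stLift_comp₂ hρc h1 (Φ := fun a b => a * b) continuous_mul
  -- the joint modulus at tolerance ε₅
  obtain ⟨ϖ₁, hϖ₁, hmod₁⟩ := rr_modulus hρc hε₅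
  obtain ⟨ϖ₂, hϖ₂, hmod₂⟩ := rr_modulus hmc hε₅
  obtain ⟨ϖ₃, hϖ₃, hmod₃⟩ := rr_modulus hEc hε₅
  set ϖ : ℝ := min ϖ₁ (min ϖ₂ ϖ₃) with hϖdef
  have hϖ : 0 < ϖ := lt_min hϖ₁ (lt_min hϖ₂ hϖ₃)
  have hϖ1 : ϖ ≤ ϖ₁ := min_le_left _ _
  have hϖ2 : ϖ ≤ ϖ₂ := (min_le_right _ _).trans (min_le_left _ _)
  have hϖ3 : ϖ ≤ ϖ₃ := (min_le_right _ _).trans (min_le_right _ _)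
  obtain ⟨r₁, hr₁, hosc⟩ := hosc
  -- the energy tie (the `χ ≡ 1` instance of (H1) at `s = 0`)
  set K : ℝ := (∫ x, totalEnergyDensity (ρ 0 x) (u 0 x) (θ 0 x)) + 1 with hKdef
  have hK : Tendsto (fun N => P N {z | K < ((N + 1 : ℕ) : ℝ)⁻¹ * configEnergy z}) atTop (𝓝 0) :=
    energyTight_of_tie Φ (hlln 0 ⟨le_rfl, hτ⟩)
  -- the output floor and resolution
  refine ⟨c, hc, fun δ hδ => ?_⟩
  refine ⟨min (ϖ / 2) (min r₁ (1 / 4)), lt_min (half_pos hϖ) (lt_min hr₁ (by norm_num)),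
    fun r hr hrr₀ => ?_⟩
  have hrϖ : r < ϖ := (hrr₀.trans_le (min_le_left _ _)).trans (half_lt_self hϖ)
  have hrr₁ : r < r₁ := hrr₀.trans_le ((min_le_right _ _).trans (min_le_left _ _))
  have hr2 : r ≤ 1 / 2 := by
    have := (min_le_right (ϖ / 2) (min r₁ (1 / 4))).trans (min_le_right _ _)
    linarith
  -- constants at fixed `r`
  set L : ℝ := 3 / (Real.pi * r ^ 4) with hLdef
  have hL : 0 < L := by positivity
  set Ka : ℝ := |K| + 1 with hKadef
  have hKa : 0 < Ka := by positivity
  have hKKa : K ≤ Ka := by have := le_abs_self K; linarith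
  set δx : ℝ := min (ϖ / 2) (ε₅ / (L * Ka)) with hδxdef
  have hδx : 0 < δx := lt_min (half_pos hϖ) (by positivity)
  have hδxϖ : δx < ϖ := (min_le_left _ _).trans_lt (half_lt_self hϖ)
  have hδx₂ : L * Ka * δx ≤ ε₅ := by
    calc L * Ka * δx ≤ L * Ka * (ε₅ / (L * Ka)) :=
          mul_le_mul_of_nonneg_left (min_le_right _ _) (by positivity)
      _ = ε₅ := by field_simp
  set V : ℝ := Real.sqrt (2 * K) with hVdef
  have hV : 0 ≤ V := Real.sqrt_nonneg _
  set δt : ℝ := min (ϖ / 2) (ε₅ / (L * (V + 1))) with hδtdef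
  have hδt : 0 < δt := lt_min (half_pos hϖ) (by positivity)
  have hδtϖ : δt < ϖ := (min_le_left _ _).trans_lt (half_lt_self hϖ)
  have hδt₂ : L * V * δt ≤ ε₅ := by
    calc L * V * δt ≤ L * (V + 1) * δt := by gcongr; linarith
      _ ≤ L * (V + 1) * (ε₅ / (L * (V + 1))) :=
          mul_le_mul_of_nonneg_left (min_le_right _ _) (by positivity)
      _ = ε₅ := by field_simp
  -- the `x`-net
  obtain ⟨Sx, hSx⟩ := gridUp_euclidNet hδx
  have hSne : Sx.Nonempty := by
    obtain ⟨y, hy, -⟩ := hSx 0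
    exact ⟨y, hy⟩
  -- the (H2) windows at tolerance ε₅
  have hwin : ∀ (l : T3) (s : ℝ), ∃ w : ℝ, 0 < w ∧ (s ∈ Icc 0 τ →
      Tendsto (fun N => P N {z | ∃ s' ∈ Icc 0 τ, |s' - s| ≤ w ∧
        ε₅ < ‖momC r ((Φ N).flow s' z) l - momC r ((Φ N).flow s z) l‖ +
          |kinC r ((Φ N).flow s' z) l - kinC r ((Φ N).flow s z) l|}) atTop (𝓝 0)) := by
    intro l s
    by_cases hs : s ∈ Icc 0 τ
    · obtain ⟨w, hw, h⟩ := hosc r hr hrr₁ l s hs ε₅ hε₅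
      exact ⟨w, hw, fun _ => h⟩
    · exact ⟨1, one_pos, fun h => absurd h hs⟩
  choose wf hwf_pos hwf using hwin
  -- the window radius about a time
  set wr : ℝ → ℝ := fun s => min δt (Sx.inf' hSne fun l => wf l s) with hwrdef
  have hwr : ∀ s, 0 < wr s := fun s =>
    lt_min hδt ((Finset.lt_inf'_iff hSne).2 fun l _ => hwf_pos l s)
  have hwr_δt : ∀ s, wr s ≤ δt := fun s => min_le_left _ _
  have hwr_wf : ∀ s, ∀ l ∈ Sx, wr s ≤ wf l s := fun s l hl =>
    (min_le_right _ _).trans (Finset.inf'_le (fun l => wf l s) hl)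
  -- the time net (compactness of `[0, τ]`)
  obtain ⟨St, hSt, hcover⟩ := isCompact_Icc.elim_nhds_subcover (fun s => Ioo (s - wr s) (s + wr s))
    (fun s _ => Ioo_mem_nhds (by linarith [hwr s]) (by linarith [hwr s]))
  have hnet : ∀ s ∈ Icc 0 τ, ∃ k ∈ St, |s - k| < wr k := by
    intro s hs
    have h := hcover hs
    simp only [mem_iUnion, exists_prop] at h
    obtain ⟨k, hk, hsk⟩ := h
    exact ⟨k, hk, abs_sub_lt_iff.2 ⟨by linarith [hsk.2], by linarith [hsk.1]⟩⟩
  -- the grid events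
  set Aρ : (N : ℕ) → ℝ → T3 → Set (Phase N) := fun N k l =>
    {z | ε₅ < |empiricalDensityField ((Φ N).flow k z) (fun y => cone r y l) - ∫ y, cone r y l * ρ k y|}
    with hAρdef
  set Am : (N : ℕ) → ℝ → T3 → Set (Phase N) := fun N k l =>
    {z | ε₅ < ‖empiricalMomentumField ((Φ N).flow k z) (fun y => cone r y l) -
      ∫ y, (cone r y l * ρ k y) • u k y‖} with hAmdef
  set Ae : (N : ℕ) → ℝ → T3 → Set (Phase N) := fun N k l =>
    {z | ε₅ < |empiricalEnergyField ((Φ N).flow k z) (fun y => cone r y l) -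
      ∫ y, cone r y l * totalEnergyDensity (ρ k y) (u k y) (θ k y)|} with hAedef
  set Ao : (N : ℕ) → ℝ → T3 → Set (Phase N) := fun N k l =>
    {z | ∃ s' ∈ Icc 0 τ, |s' - k| ≤ wf l k ∧
      ε₅ < ‖momC r ((Φ N).flow s' z) l - momC r ((Φ N).flow k z) l‖ +
        |kinC r ((Φ N).flow s' z) l - kinC r ((Φ N).flow k z) l|} with hAodef
  set En : (N : ℕ) → Set (Phase N) := fun N => {z | K < ((N + 1 : ℕ) : ℝ)⁻¹ * configEnergy z}
    with hEndef
  -- their laws vanish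
  have hχ : ∀ l : T3, Continuous fun y : T3 => cone r y l := fun l => densMod_continuous_cone r l
  have hAρ : ∀ k ∈ St, ∀ l, Tendsto (fun N => P N (Aρ N k l)) atTop (𝓝 0) :=
    fun k hk l => (hlln k (hSt k hk) _ (hχ l) ε₅ hε₅).1
  have hAm : ∀ k ∈ St, ∀ l, Tendsto (fun N => P N (Am N k l)) atTop (𝓝 0) :=
    fun k hk l => (hlln k (hSt k hk) _ (hχ l) ε₅ hε₅).2.1
  have hAe : ∀ k ∈ St, ∀ l, Tendsto (fun N => P N (Ae N k l)) atTop (𝓝 0) :=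
    fun k hk l => (hlln k (hSt k hk) _ (hχ l) ε₅ hε₅).2.2
  have hAo : ∀ k ∈ St, ∀ l, Tendsto (fun N => P N (Ao N k l)) atTop (𝓝 0) :=
    fun k hk l => hwf l k (hSt k hk)
  set f : ℕ → ℝ≥0∞ := fun N => P N (En N) +
    ∑ k ∈ St, ∑ l ∈ Sx, (P N (Aρ N k l) + P N (Am N k l) + P N (Ae N k l) + P N (Ao N k l))
    with hfdef
  have hf : Tendsto f atTop (𝓝 0) := by
    have hsum : Tendsto (fun N => ∑ k ∈ St, ∑ l ∈ Sx,
        (P N (Aρ N k l) + P N (Am N k l) + P N (Ae N k l) + P N (Ao N k l))) atTop (𝓝 0) := by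
      have h := tendsto_finsetSum St fun k hk => tendsto_finsetSum Sx fun l (_ : l ∈ Sx) =>
        (((hAρ k hk l).add (hAm k hk l)).add (hAe k hk l)).add (hAo k hk l)
      simpa only [Finset.sum_const_zero, add_zero] using h
    simpa only [add_zero] using hK.add hsum
  -- KEY (deterministic): off the grid events, a good configuration of energy `≤ K` is regular
  have hmod₁' : ∀ s ∈ Icc 0 τ, ∀ s' ∈ Icc 0 τ, |s - s'| < ϖ → ∀ x x' : T3, Torus.euclidDist x x' < ϖ →
      |ρ s x - ρ s' x'| ≤ ε / 5 := fun s hs s' hs' hss' x x' hxx' => by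
    have h := hmod₁ s hs s' hs' (hss'.trans_le hϖ1) x x' (hxx'.trans_le hϖ1)
    rw [Real.norm_eq_abs] at h
    exact h.le
  have hmod₂' : ∀ s ∈ Icc 0 τ, ∀ s' ∈ Icc 0 τ, |s - s'| < ϖ → ∀ x x' : T3, Torus.euclidDist x x' < ϖ →
      ‖ρ s x • u s x - ρ s' x' • u s' x'‖ ≤ ε / 5 := fun s hs s' hs' hss' x x' hxx' =>
    (hmod₂ s hs s' hs' (hss'.trans_le hϖ2) x x' (hxx'.trans_le hϖ2)).le
  have hmod₃' : ∀ s ∈ Icc 0 τ, ∀ s' ∈ Icc 0 τ, |s - s'| < ϖ → ∀ x x' : T3, Torus.euclidDist x x' < ϖ →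
      |totalEnergyDensity (ρ s x) (u s x) (θ s x) - totalEnergyDensity (ρ s' x') (u s' x') (θ s' x')| ≤ ε / 5 :=
    fun s hs s' hs' hss' x x' hxx' => by
      have h := hmod₃ s hs s' hs' (hss'.trans_le hϖ3) x x' (hxx'.trans_le hϖ3)
      rw [Real.norm_eq_abs] at h
      exact h.le
  have hcap : ∀ s ∈ Icc 0 τ, ∀ x, ρ s x * σ ^ 3 + ε * |σ ^ 3| ≤ η₁ := fun s hs x => by
    have h1 : g₀ ≤ η₁ - ρ s x * σ ^ 3 := hg₀le s hs x
    have h2 : ε * |σ ^ 3| ≤ ε * (|σ ^ 3| + 1) := mul_le_mul_of_nonneg_left (by linarith) hε.le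
    linarith
  have hnet' : ∀ s ∈ Icc 0 τ, ∃ k ∈ St, |s - k| ≤ δt ∧ ∀ l ∈ Sx, |s - k| ≤ wf l k := fun s hs => by
    obtain ⟨k, hk, hsk⟩ := hnet s hs
    exact ⟨k, hk, hsk.le.trans (hwr_δt k), fun l hl => hsk.le.trans (hwr_wf k l hl)⟩
  have key : ∀ (N : ℕ) (z : Phase N), z ∈ (Φ N).good → ((N + 1 : ℕ) : ℝ)⁻¹ * configEnergy z ≤ K →
      (∀ k ∈ St, ∀ l ∈ Sx, z ∉ Aρ N k l ∧ z ∉ Am N k l ∧ z ∉ Ae N k l ∧ z ∉ Ao N k l) →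
      Regular σ r τ c η₁ (Φ N) z := by
    intro N z hg hKz hA
    refine regular_of_gridEvents σ η₁ τ c ε B K r δx δt ϖ ρ θ u hr hr2 hrϖ hc hε hB0 hεD hcρ hcθ hBle hcap
      (fun s hs => Torus.continuous_slice_of_continuousOn_stLift hρc hs)
      (fun s hs => Torus.continuous_slice_of_continuousOn_stLift hmc hs)
      (fun s hs => Torus.continuous_slice_of_continuousOn_stLift hEc hs)
      hmod₁' hmod₂' hmod₃' hδxϖ hδtϖ hδx₂ hδt₂ Sx hSx St hSt wf hnet' N (Φ N) z hg hKz fun k hk l hl => ?_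
    obtain ⟨hzρ, hzm, hze, hzo⟩ := hA k hk l hl
    refine ⟨not_lt.1 hzρ, not_lt.1 hzm, not_lt.1 hze, fun s' hs' hs'k => ?_⟩
    by_contra hcon
    exact hzo ⟨s', hs', hs'k, lt_of_not_ge hcon⟩
  -- the measure bound
  have hdom : ∀ N, P N {z | ¬ Regular σ r τ c η₁ (Φ N) z} ≤ f N := by
    intro N
    have hsub : {z | ¬ Regular σ r τ c η₁ (Φ N) z} ⊆
        ((⋃ k ∈ St, ⋃ l ∈ Sx, (Aρ N k l ∪ Am N k l ∪ Ae N k l ∪ Ao N k l)) ∪ (Φ N).goodᶜ) ∪ En N := by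
      intro z hz
      by_cases hg : z ∈ (Φ N).good
      · by_cases hKz : ((N + 1 : ℕ) : ℝ)⁻¹ * configEnergy z ≤ K
        · by_contra hcon
          apply hz
          refine key N z hg hKz fun k hk l hl => ?_
          have hnot : z ∉ (Aρ N k l ∪ Am N k l ∪ Ae N k l ∪ Ao N k l) := fun hin =>
            hcon (Or.inl (Or.inl (Set.mem_iUnion₂.2 ⟨k, hk, Set.mem_iUnion₂.2 ⟨l, hl, hin⟩⟩)))
          simp only [Set.mem_union, not_or] at hnot
          exact ⟨hnot.1.1.1, hnot.1.1.2, hnot.1.2, hnot.2⟩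
        · exact Or.inr (not_le.1 hKz)
      · exact Or.inl (Or.inr hg)
    have hU4 : ∀ k l, P N (Aρ N k l ∪ Am N k l ∪ Ae N k l ∪ Ao N k l) ≤
        P N (Aρ N k l) + P N (Am N k l) + P N (Ae N k l) + P N (Ao N k l) := fun k l =>
      (measure_union_le _ _).trans (add_le_add ((measure_union_le _ _).trans
        (add_le_add (measure_union_le _ _) le_rfl)) le_rfl)
    have hU : P N (⋃ k ∈ St, ⋃ l ∈ Sx, (Aρ N k l ∪ Am N k l ∪ Ae N k l ∪ Ao N k l)) ≤
        ∑ k ∈ St, ∑ l ∈ Sx, (P N (Aρ N k l) + P N (Am N k l) + P N (Ae N k l) + P N (Ao N k l)) :=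
      (measure_biUnion_finset_le St _).trans (Finset.sum_le_sum fun k _ =>
        (measure_biUnion_finset_le Sx _).trans (Finset.sum_le_sum fun l _ => hU4 k l))
    calc P N {z | ¬ Regular σ r τ c η₁ (Φ N) z}
        ≤ P N (((⋃ k ∈ St, ⋃ l ∈ Sx, (Aρ N k l ∪ Am N k l ∪ Ae N k l ∪ Ao N k l)) ∪ (Φ N).goodᶜ) ∪
            En N) := measure_mono hsub
      _ ≤ P N (⋃ k ∈ St, ⋃ l ∈ Sx, (Aρ N k l ∪ Am N k l ∪ Ae N k l ∪ Ao N k l)) + P N (Φ N).goodᶜ +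
            P N (En N) := (measure_union_le _ _).trans (add_le_add (measure_union_le _ _) le_rfl)
      _ ≤ (∑ k ∈ St, ∑ l ∈ Sx, (P N (Aρ N k l) + P N (Am N k l) + P N (Ae N k l) + P N (Ao N k l))) +
            0 + P N (En N) :=
          add_le_add (add_le_add hU (le_of_eq (gridUp_localGibbsLaw_compl_good σ a₀ θ₀ u₀ N (Φ N)))) le_rfl
      _ = f N := by rw [add_zero, add_comm]
  -- `Tendsto ⇒ ∃ N₀`
  have hev : ∀ᶠ N in atTop, f N < ENNReal.ofReal δ :=
    (tendsto_order.1 hf).2 _ (ENNReal.ofReal_pos.2 hδ)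
  obtain ⟨N₀, hN₀⟩ := eventually_atTop.1 hev
  exact ⟨N₀, fun N hN => (hdom N).trans (hN₀ N hN).le⟩

/-- **The same reduction in the crux's frame** (pre-shock, `τ < T`): for a classical hard-sphere Euler
solution the continuity and positivity inputs are automatic (`IsHardSphereEulerSolution`), so the regular
range on `[0, τ]` follows from the cap-in-band condition `ρσ³ < η₁` on `[0, τ] × 𝕋³`, the fixed-time field
LLN (H1) on `[0, τ]` (the hydrodynamic limit up to `τ`) and the time-equicontinuity (H2). -/
theorem regularRange_of_fieldLLN_euler {σ η₁ τ T : ℝ} {a₀ θ₀ : T3 → ℝ} {u₀ : T3 → V3}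
    (Φ : (N : ℕ) → Flow σ N) {ρ θ : ℝ → T3 → ℝ} {u : ℝ → T3 → V3}
    (hE : IsHardSphereEulerSolution σ T ρ u θ) (hτT : τ < T)
    (hband : ∀ s ∈ Set.Icc 0 τ, ∀ x, ρ s x * σ ^ 3 < η₁)
    (hlln : ∀ s ∈ Set.Icc 0 τ, TendstoHydroFieldsAt (fun N => localGibbsLaw σ a₀ u₀ θ₀ N (Φ N)) Φ ρ u θ s)
    (hosc : ∃ r₁ : ℝ, 0 < r₁ ∧ ∀ r : ℝ, 0 < r → r < r₁ → ∀ x : T3, ∀ s ∈ Set.Icc 0 τ, ∀ ε : ℝ, 0 < ε →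
      ∃ ϖ : ℝ, 0 < ϖ ∧ Tendsto (fun N => localGibbsLaw σ a₀ u₀ θ₀ N (Φ N)
        {z | ∃ s' ∈ Set.Icc 0 τ, |s' - s| ≤ ϖ ∧
          ε < ‖momC r ((Φ N).flow s' z) x - momC r ((Φ N).flow s z) x‖ +
            |kinC r ((Φ N).flow s' z) x - kinC r ((Φ N).flow s z) x|}) atTop (𝓝 0)) :
    ∃ c : ℝ, 0 < c ∧ ∀ δ : ℝ, 0 < δ → ∃ r₀ : ℝ, 0 < r₀ ∧ ∀ r : ℝ, 0 < r → r < r₀ →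
      ∃ N₀ : ℕ, ∀ N : ℕ, N₀ ≤ N →
        localGibbsLaw σ a₀ u₀ θ₀ N (Φ N) {z | ¬ Regular σ r τ c η₁ (Φ N) z} ≤ ENNReal.ofReal δ := by
  have hsub : Set.Icc 0 τ ×ˢ (Set.univ : Set (EuclideanSpace ℝ (Fin 3))) ⊆ Set.Ico 0 T ×ˢ Set.univ :=
    prod_mono (Icc_subset_Ico_right hτT) Subset.rfl
  have hI : ∀ s ∈ Icc 0 τ, s ∈ Ico 0 T := fun s hs => ⟨hs.1, hs.2.trans_lt hτT⟩
  exact regularRange_of_fieldLLN σ η₁ τ a₀ θ₀ u₀ Φ ρ θ u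
    (hE.smooth_density.continuousOn_stLift.mono hsub) (hE.smooth_velocity.continuousOn_stLift.mono hsub)
    (hE.smooth_temperature.continuousOn_stLift.mono hsub)
    (fun s hs x => ⟨hE.density_pos s (hI s hs) x, hE.temperature_pos s (hI s hs) x, hband s hs x⟩) hlln hosc

end Summit.AtomisticToContinuum.HydrodynamicLimit.Theorems.LocalSecondLawLedger

end
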